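import Summits.Ventures.PercRepro.PuncturedLYMCoHypSeq2

/-!
# PercRepro — TWO DISJOINT CO-HYPERPLANES, PART 3: THE SUPERPOSITION OF THE TWO ONE-CO-HYPERPLANE FLOWS (p10, gen 34)

Arithmetic only (imports Mathlib and the gen-33 sequences).  For two disjoint co-hyperplanes of sizes `m₁, m₂` on `n`
points at level `j`, the SUPERPOSITION of the two one-co-hyperplane flows of gen 33 minus the free flow `1/(n − j)`:
on the profile `(a, b)`, `supA = yv¹ a + xv² b − 1/(n−j)` (a point of `C₁` added), `supB = xv¹ a + yv² b − 1/(n−j)`,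
`supR = xv¹ a + xv² b − 1/(n−j)`; the column target `twoK = k₁ + k₂ − (j + 1)/(n − j)` (`= #P/C(n, j+1)`).
* `sup_row` — the rows sum to `1` on every profile `a < m₁`, `b < m₂`;
* `sup_col` — the untouched columns sum to `twoK` on every profile `a' < m₁`, `b' < m₂`;
* `sup_top₁` / `sup_top₂` — the touched columns sum to `twoK + m₁·(xv² b' − 1/(n−j)) + (…)`: the ERROR of the
  superposition at the touched columns, `err₁ b' = m₁·(xv² b' − 1/(n−j)) + (k₂ − (j+1)/(n−j))·0 …` (stated as an
  identity for `m₁·supA (m₁ − 1) b'`).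
The boundary correction (proofs/P10-BOUNDARY-g34.md §2′) is NOT constructed here; nothing asserts (SP), (PAV) or (NC).
-/

namespace PercRepro.PuncturedLYM

open Finset

/-- The column target for two co-hyperplanes: `k₁ + k₂ − (j + 1)/(n − j)`. -/
def twoK (n j m₁ m₂ : ℕ) : ℚ := coK n j m₁ + coK n j m₂ - ((j : ℚ) + 1) / ((n - j : ℕ) : ℚ)

/-- The superposition weight for a point of `C₁` added to a set of profile `(a, b)`. -/
def supA (n j m₁ m₂ a b : ℕ) : ℚ := coYv n j m₁ a + coXv n j m₂ b - 1 / ((n - j : ℕ) : ℚ)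

/-- The superposition weight for a point of `C₂` added. -/
def supB (n j m₁ m₂ a b : ℕ) : ℚ := coXv n j m₁ a + coYv n j m₂ b - 1 / ((n - j : ℕ) : ℚ)

/-- The superposition weight for a point outside `C₁ ∪ C₂` added. -/
def supR (n j m₁ m₂ a b : ℕ) : ℚ := coXv n j m₁ a + coXv n j m₂ b - 1 / ((n - j : ℕ) : ℚ)

/-- **The rows of the superposition sum to `1`** on every profile `a < m₁`, `b < m₂` (`2j + 1 ≤ n`). -/
theorem sup_row {n j m₁ m₂ a b : ℕ} (hm₁ : 1 ≤ m₁) (hm₁j : m₁ ≤ j) (hm₂ : 1 ≤ m₂) (hm₂j : m₂ ≤ j)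
    (hn : 2 * j + 1 ≤ n) (ha : a < m₁) (hb : b < m₂) :
    ((m₁ : ℚ) - a) * supA n j m₁ m₂ a b + ((m₂ : ℚ) - b) * supB n j m₁ m₂ a b +
      ((n : ℚ) - j - m₁ - m₂ + a + b) * supR n j m₁ m₂ a b = 1 := by
  have r1 := coSeq_row hm₁ hm₁j hn ha
  have r2 := coSeq_row hm₂ hm₂j hn hb
  have hnj : ((n - j : ℕ) : ℚ) = (n : ℚ) - j := by
    rw [Nat.cast_sub (by omega)]
  have hpos : (n : ℚ) - j ≠ 0 := by
    have : (j : ℚ) + 1 ≤ n := by exact_mod_cast (show j + 1 ≤ n by omega)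
    linarith
  unfold supA supB supR
  rw [hnj]
  field_simp
  linear_combination ((n : ℚ) - j) * (r1 + r2)

/-- **The untouched columns of the superposition sum to `twoK`** on every profile `a' < m₁`, `b' < m₂`. -/
theorem sup_col {n j m₁ m₂ a' b' : ℕ} (hm₁ : 1 ≤ m₁) (hm₁j : m₁ ≤ j) (hm₂ : 1 ≤ m₂) (hm₂j : m₂ ≤ j)
    (hn : 2 * j + 1 ≤ n) (ha : a' < m₁) (hb : b' < m₂) :
    (a' : ℚ) * supA n j m₁ m₂ (a' - 1) b' + (b' : ℚ) * supB n j m₁ m₂ a' (b' - 1) +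
      ((j : ℚ) + 1 - a' - b') * supR n j m₁ m₂ a' b' = twoK n j m₁ m₂ := by
  have c1 : (a' : ℚ) * coYv n j m₁ (a' - 1) + ((j : ℚ) + 1 - a') * coXv n j m₁ a' = coK n j m₁ := by
    rcases Nat.eq_zero_or_pos a' with h0 | h0
    · subst h0
      have := coSeq_col0 n j m₁
      push_cast
      linarith
    · exact coSeq_col hm₁ hm₁j hn h0 ha
  have c2 : (b' : ℚ) * coYv n j m₂ (b' - 1) + ((j : ℚ) + 1 - b') * coXv n j m₂ b' = coK n j m₂ := by
    rcases Nat.eq_zero_or_pos b' with h0 | h0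
    · subst h0
      have := coSeq_col0 n j m₂
      push_cast
      linarith
    · exact coSeq_col hm₂ hm₂j hn h0 hb
  unfold supA supB supR twoK
  linear_combination c1 + c2

/-- **The touched columns of `C₁`**: `m₁·supA (m₁ − 1) b' = twoK + m₁·(xv² b' − 1/(n−j)) − (k₂ − (j + 1)/(n − j))`,
i.e. the column sum is `twoK + err₁ b'` with `err₁ b' = m₁·coXv n j m₂ b' − (m₁ − j − 1)/(n − j) − coK n j m₂`
(the error vanishes exactly when `xv² b'` equals the free flow corrected by `(k₂ − (j+1)/(n−j))/m₁`). -/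
theorem sup_top₁ {n j m₁ m₂ b' : ℕ} (hm₁ : 1 ≤ m₁) (hm₁j : m₁ ≤ j) (hn : 2 * j + 1 ≤ n) :
    (m₁ : ℚ) * supA n j m₁ m₂ (m₁ - 1) b' =
      twoK n j m₁ m₂ + ((m₁ : ℚ) * coXv n j m₂ b' - (m₁ : ℚ) / ((n - j : ℕ) : ℚ)
        - (coK n j m₂ - ((j : ℚ) + 1) / ((n - j : ℕ) : ℚ))) := by
  have t := coSeq_top hm₁ hm₁j hn
  unfold supA twoK
  linear_combination t

/-- **The touched columns of `C₂`**: symmetric. -/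
theorem sup_top₂ {n j m₁ m₂ a' : ℕ} (hm₂ : 1 ≤ m₂) (hm₂j : m₂ ≤ j) (hn : 2 * j + 1 ≤ n) :
    (m₂ : ℚ) * supB n j m₁ m₂ a' (m₂ - 1) =
      twoK n j m₁ m₂ + ((m₂ : ℚ) * coXv n j m₁ a' - (m₂ : ℚ) / ((n - j : ℕ) : ℚ)
        - (coK n j m₁ - ((j : ℚ) + 1) / ((n - j : ℕ) : ℚ))) := by
  have t := coSeq_top hm₂ hm₂j hn
  unfold supB twoK
  linear_combination t

/-- The superposition weights are bounded below by `1 − k₁/(j+1)·ξ¹ …`: on the interior every weight is at least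
`supR`, and `supA ≥ supR`, `supB ≥ supR` (`η ≥ 0 ≥ −ξ`). -/
theorem supR_le_supA {n j m₁ m₂ a b : ℕ} (hm₁ : 1 ≤ m₁) (hm₁j : m₁ ≤ j) (hn : 2 * j + 1 ≤ n) :
    supR n j m₁ m₂ a b ≤ supA n j m₁ m₂ a b := by
  unfold supR supA
  have hk := coK_pos hm₁ hm₁j hn
  have hj : (0 : ℚ) < (j : ℚ) + 1 := by positivity
  have h1 : coXv n j m₁ a ≤ coYv n j m₁ a := by
    unfold coXv coYv
    apply mul_le_mul_of_nonneg_left _ (div_pos hk hj).le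
    have := coEta_nonneg (c := a) hm₁ hm₁j hn
    have := coXi_nonneg (n := n) (j := j) (m := m₁) (c := a) hm₁ hm₁j hn
    linarith
  linarith

end PercRepro.PuncturedLYM
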